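import Summits.ResolutionOfSingularities.ResolutionOfSingularities.Theorems.EquisingularLiftEquisingularLiftNatSmoothConeBlowupChart
import HarnessLib

/-!
# [OURS · L1 W4.5(b) · EL♮(3)] E-NEG(1) (iv), RING CORE: a NON-EQUIMULTIPLE lift has strict transform CONTAINING THE WHOLE
# EXCEPTIONAL FIBRE CHART over the special point — `g₁ ∈ (xᵢ, ϖ)·A[I/xᵢ]`, and the two primes `(xᵢ, ϖ) < (xᵢ, ϖ, x/xᵢ)` over `𝔪`

Support file of the crux chain w45b (cell `res-hironaka`, slot W4.5(b)), working crux **EL♮** = stmt-ResolutionOfSingularities-20038,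
child **EL♮(3)** = stmt-ResolutionOfSingularities-20148, route EquisingularLift, line `sections`; object **E-NEG(1) (iv)(b) RING CORE**
as specified by res-L1-w45b-stub-4 (STATUS 2026-08-27T14:35:18Z (3) / DESIGN NOTES 14:40:50Z (2)), booked by res-L1-w45b-plan-1
RULING 14:38:30Z (R-E). HONEST FRAMING: OURS; NOT a statement of any manuscript; AI-written, weaker than expert review. No `sorry`;
standard axioms. DEF-FREE. `--supports stmt-ResolutionOfSingularities-20148 --as helper`.

SETTING = res-L1-w45b-stub-3's T-M1-EXACT / `…NatSmoothConeBlowupChart` (p511641): `A` any commutative ring, `x = (x₁,…,x_r)`,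
`I = (x)` (the ideal of the SECTION), `ϖ ∈ A` (the uniformizer; `I + (ϖ) = 𝔪` the ideal of the special POINT), `B = A[I/xᵢ]`,
`t = xᵢ/1`, `e_j = x_j/xᵢ`; the hypersurface `G = Φ(x) + Ψ`, `Φ` a form of degree `μ`, `Ψ ∈ I^{μ+1}`, with strict-transform
generator `g₁ = Φ(e) + t ψ` on the chart (`exists_algebraMap_tangentCone_eq`).

NON-EQUIMULTIPLICITY := «every coefficient of `Φ` lies in `I + (ϖ)`», i.e. the reduction `ḡ = G mod ϖ` has order `> μ = ord_I G` at
the special point (`ord_q ḡ > ord_s G`). THEN (this file):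
* `aeval_frac_mem_map_of_forall_coeff_mem` — coefficients of `Φ` in `J` ⇒ `Φ(e) ∈ J·B`;
* `map_span_range_sup_span_singleton` — `(I + (ϖ))·B = (t) + (ϖ)`;
* **`strictTransform_mem_of_forall_coeff_mem`** — `g₁ = Φ(e) + tψ ∈ (t, ϖ)·B`: on EVERY chart the strict transform `V(g₁)`
  CONTAINS the whole exceptional fibre chart `V(t, ϖ) ≅ 𝔸^{r-1}_{A/𝔪}` over the special point (the converse companion of
  T-M1-EXACT's `map_blowupAlgebraMap_strictTransformIdeal_eq`: exactness ⟸ equimultiplicity);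
* `iSup_colon_le_of_forall_coeff_mem` — hence (for `x` quasi-regular and `Φ̄ᵢ ≠ 0` over `A/I`, where the strict-transform ideal is
  `(g₁)`, part 1's `iSup_colon_span_tangentCone_eq_span_strictTransform`) `⋃ₙ ((G) : tⁿ) ≤ (t, ϖ)`;
* the TWO PRIMES of the exceptional fibre chart over `𝔪 = I + (ϖ)` (for `x` quasi-regular and `I + (ϖ)` prime; both spelled inline,
  no definition): `(t) + (ϖ)` is PRIME with `A ∩ (t, ϖ) = I + (ϖ)` (`isPrime_span_sup_span`, `comap_algebraMap_span_sup_span`), and the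
  VERTEX ideal `(t, ϖ, e_j : j ≠ i) = (𝔪.comap constantCoeff)·B` (image under `eval` of the polynomials with constant term in `𝔪`) is
  PRIME, lies over `I + (ϖ)`, contains `(t, ϖ)` and every `e_j`, and differs from `(t, ϖ)` as soon as `r ≥ 2`
  (`isPrime_map_eval_comap_constantCoeff`, `comap_algebraMap_map_eval_comap_constantCoeff`, `span_sup_span_le_map_eval_comap_constantCoeff`,
  `frac_mem_map_eval_comap_constantCoeff`, `span_sup_span_ne_map_eval_comap_constantCoeff`) — the input «two primes `P₁ < P₀` of the
  chart ring over `𝔪_y` containing `g₁`» of res-L1-w45b-stub-4's scheme route (3) (T-FIBRE pattern).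

References: The Stacks Project, Tags 052Q, 0BIQ; Görtz–Wedhorn, *Algebraic Geometry I* (2020), (13.19). Tree inputs: `…NatSmoothConeBlowupChart`
(p511641, res-L1-w45b-stub-3), `BlowupAlgebraPresentation` (`blowupAlgebra.eval`, `comap_eval_span_algebraMap_eq`, `isPrime_map_eval`,
`comap_map_eval`).
-/

set_option linter.dupNamespace false -- mandated namespace `Summit.<Summit>.<Problem>` of this single-conjunct summit

noncomputable section

namespace Summit.ResolutionOfSingularities.ResolutionOfSingularities.Cruxes.EquisingularLiftNat.Sections

open MvPolynomial Literature.AlgebraicGeometry.Resolution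

universe u

section NonEquimultiple

variable {A : Type u} [CommRing A] {r : ℕ} (x : Fin r → A) (i : Fin r)

/-! ## `g₁ ∈ (t, ϖ)` -/

/-- **Coefficients in `J` ⇒ `Φ(e) ∈ J·A[I/xᵢ]`.** [folklore] -/
theorem aeval_frac_mem_map_of_forall_coeff_mem (J : Ideal A) (Φ : MvPolynomial (Fin r) A) (hΦ : ∀ α, Φ.coeff α ∈ J) :
    MvPolynomial.aeval (blowupAlgebra.frac x i) Φ ∈ J.map (algebraMap A (blowupAlgebra (Ideal.span (Set.range x)) (x i))) := by
  rw [MvPolynomial.as_sum Φ, map_sum]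
  refine Ideal.sum_mem _ fun α _ => ?_
  rw [MvPolynomial.aeval_monomial]
  exact Ideal.mul_mem_right _ _ (Ideal.mem_map_of_mem _ (hΦ α))

/-- **`(I + (ϖ))·A[I/xᵢ] = (t) + (ϖ)`** (`I·A[I/xᵢ] = (t)`, Stacks 052Q). [cite: StacksProject, Tag 052Q] -/
theorem map_span_range_sup_span_singleton (ϖ : A) :
    (Ideal.span (Set.range x) ⊔ Ideal.span {ϖ}).map (algebraMap A (blowupAlgebra (Ideal.span (Set.range x)) (x i))) =
      Ideal.span {algebraMap A (blowupAlgebra (Ideal.span (Set.range x)) (x i)) (x i)} ⊔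
        Ideal.span {algebraMap A (blowupAlgebra (Ideal.span (Set.range x)) (x i)) ϖ} := by
  rw [Ideal.map_sup, map_blowupAlgebra_eq_span (blowupAlgebra.mem_span_range x i), Ideal.map_span, Set.image_singleton]

/-- **E-NEG(1) (iv), ring core: a NON-EQUIMULTIPLE lift has strict transform containing the whole exceptional fibre chart.**
If every coefficient of the degree-`μ` form `Φ` lies in `I + (ϖ)` (the reduction modulo `ϖ` has order `> μ` at the special point),
then on the chart `A[I/xᵢ]` the strict-transform generator `g₁ = Φ(e) + tψ` lies in `(t, ϖ)`: `V(g₁) ⊇ V(t, ϖ) ≅ 𝔸^{r-1}` over the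
special point. [cite: GortzWedhorn2020, (13.19) p. 414] [OURS · L1 W4.5b · E-NEG(1) (iv)] -/
theorem strictTransform_mem_of_forall_coeff_mem (ϖ : A) (Φ : MvPolynomial (Fin r) A)
    (hΦ : ∀ α, Φ.coeff α ∈ Ideal.span (Set.range x) ⊔ Ideal.span {ϖ})
    (ψ : blowupAlgebra (Ideal.span (Set.range x)) (x i)) :
    MvPolynomial.aeval (blowupAlgebra.frac x i) Φ + algebraMap A (blowupAlgebra (Ideal.span (Set.range x)) (x i)) (x i) * ψ ∈
      Ideal.span {algebraMap A (blowupAlgebra (Ideal.span (Set.range x)) (x i)) (x i)} ⊔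
        Ideal.span {algebraMap A (blowupAlgebra (Ideal.span (Set.range x)) (x i)) ϖ} := by
  refine add_mem ?_ (Ideal.mem_sup_left (Ideal.mul_mem_right _ _ (Ideal.mem_span_singleton_self _)))
  rw [← map_span_range_sup_span_singleton x i ϖ]
  exact aeval_frac_mem_map_of_forall_coeff_mem x i _ Φ hΦ

/-- Hence the whole STRICT-TRANSFORM IDEAL `⋃ₙ ((G) : tⁿ)` of `G = Φ(x) + Ψ` lies in `(t, ϖ)` — for `x` quasi-regular and `Φ̄ᵢ ≠ 0`
over `A/I` (then it is `(g₁)`, part 1's `iSup_colon_span_tangentCone_eq_span_strictTransform`). [cite: StacksProject, Tag 0BIQ] -/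
theorem iSup_colon_le_of_forall_coeff_mem (hx : IsQuasiRegular x) [IsDomain (A ⧸ Ideal.span (Set.range x))]
    (ϖ : A) {μ : ℕ} (Φ : MvPolynomial (Fin r) A)
    (hΦi : MvPolynomial.map (Ideal.Quotient.mk (Ideal.span (Set.range x))) (dehomogenize i Φ) ≠ 0)
    (hΦ : ∀ α, Φ.coeff α ∈ Ideal.span (Set.range x) ⊔ Ideal.span {ϖ})
    (ψ : blowupAlgebra (Ideal.span (Set.range x)) (x i)) {G : A}
    (hG : algebraMap A (blowupAlgebra (Ideal.span (Set.range x)) (x i)) G =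
      algebraMap A (blowupAlgebra (Ideal.span (Set.range x)) (x i)) (x i) ^ μ *
        (MvPolynomial.aeval (blowupAlgebra.frac x i) Φ +
          algebraMap A (blowupAlgebra (Ideal.span (Set.range x)) (x i)) (x i) * ψ)) :
    ⨆ n : ℕ, Submodule.colon
        (Ideal.span {algebraMap A (blowupAlgebra (Ideal.span (Set.range x)) (x i)) G})
        ((Ideal.span {algebraMap A (blowupAlgebra (Ideal.span (Set.range x)) (x i)) (x i)} ^ n :
          Ideal (blowupAlgebra (Ideal.span (Set.range x)) (x i))) : Set _) ≤
      Ideal.span {algebraMap A (blowupAlgebra (Ideal.span (Set.range x)) (x i)) (x i)} ⊔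
        Ideal.span {algebraMap A (blowupAlgebra (Ideal.span (Set.range x)) (x i)) ϖ} := by
  rw [iSup_colon_span_tangentCone_eq_span_strictTransform x i hx (d := μ) hΦi ψ hG, Ideal.span_singleton_le_iff_mem]
  exact strictTransform_mem_of_forall_coeff_mem x i ϖ Φ hΦ ψ

/-! ## The two primes `(t, ϖ) < (t, ϖ, e)` of the exceptional fibre chart over `𝔪 = I + (ϖ)` -/

/-- `eval ∘ C = algebraMap` for the presentation `eval : A[T_j : j ≠ i] → A[I/xᵢ]`. [folklore] -/
theorem eval_comp_C :
    (blowupAlgebra.eval x i).toRingHom.comp MvPolynomial.C = algebraMap A (blowupAlgebra (Ideal.span (Set.range x)) (x i)) :=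
  RingHom.ext fun a => by simp

/-- `(t) + (ϖ) = (𝔪·A[T])·A[I/xᵢ]` with `𝔪 = I + (ϖ)`: the image under `eval` of the extended ideal `Ideal.map C 𝔪`. [folklore] -/
theorem map_eval_map_C_eq (ϖ : A) :
    (Ideal.map MvPolynomial.C (Ideal.span (Set.range x) ⊔ Ideal.span {ϖ}) :
        Ideal (MvPolynomial {j : Fin r // j ≠ i} A)).map (blowupAlgebra.eval x i).toRingHom =
      Ideal.span {algebraMap A (blowupAlgebra (Ideal.span (Set.range x)) (x i)) (x i)} ⊔
        Ideal.span {algebraMap A (blowupAlgebra (Ideal.span (Set.range x)) (x i)) ϖ} := by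
  rw [Ideal.map_map, eval_comp_C, map_span_range_sup_span_singleton]

/-- `ker eval ≤ Ideal.map C 𝔪` (the relations of the chart algebra modulo `xᵢ` are `I·A[T]`, Stacks 0BIQ; `x` quasi-regular).
[cite: StacksProject, Tag 0BIQ] -/
theorem ker_eval_le_map_C (hx : IsQuasiRegular x) (ϖ : A) :
    RingHom.ker (blowupAlgebra.eval x i).toRingHom ≤
      (Ideal.map MvPolynomial.C (Ideal.span (Set.range x) ⊔ Ideal.span {ϖ}) : Ideal (MvPolynomial {j : Fin r // j ≠ i} A)) := by
  refine le_trans ?_ (Ideal.map_mono le_sup_left)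
  rw [← blowupAlgebra.comap_eval_span_algebraMap_eq x i hx, RingHom.ker_eq_comap_bot]
  exact Ideal.comap_mono bot_le

/-- `P·A[T]` is prime for `P` prime (it is the kernel of `A[T] → (A/P)[T]`, a domain). [folklore] -/
theorem isPrime_map_C_mvPolynomial {σ : Type*} (P : Ideal A) [P.IsPrime] :
    (Ideal.map (MvPolynomial.C : A →+* MvPolynomial σ A) P).IsPrime := by
  have h : Ideal.map (MvPolynomial.C : A →+* MvPolynomial σ A) P =
      RingHom.ker (MvPolynomial.map (Ideal.Quotient.mk P) : MvPolynomial σ A →+* MvPolynomial σ (A ⧸ P)) := by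
    rw [MvPolynomial.ker_map, Ideal.mk_ker]
  rw [h]
  exact RingHom.ker_isPrime _

/-- **`(t, ϖ)` is prime** when `I + (ϖ)` is prime and `x` quasi-regular (`A[I/xᵢ]/(t, ϖ) ≅ (A/(I + (ϖ)))[T_j : j ≠ i]`).
[cite: StacksProject, Tag 0BIQ] -/
theorem isPrime_span_sup_span (hx : IsQuasiRegular x) (ϖ : A) [(Ideal.span (Set.range x) ⊔ Ideal.span {ϖ}).IsPrime] :
    (Ideal.span {algebraMap A (blowupAlgebra (Ideal.span (Set.range x)) (x i)) (x i)} ⊔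
      Ideal.span {algebraMap A (blowupAlgebra (Ideal.span (Set.range x)) (x i)) ϖ}).IsPrime := by
  rw [← map_eval_map_C_eq x i ϖ]
  haveI : (Ideal.map MvPolynomial.C (Ideal.span (Set.range x) ⊔ Ideal.span {ϖ}) :
      Ideal (MvPolynomial {j : Fin r // j ≠ i} A)).IsPrime := isPrime_map_C_mvPolynomial _
  exact blowupAlgebra.isPrime_map_eval x i (ker_eval_le_map_C x i hx ϖ)

/-- `A ∩ Ideal.map C J = J` in `A[T]`. [folklore] -/
theorem comap_C_map_C {σ : Type*} (J : Ideal A) :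
    (Ideal.map (MvPolynomial.C : A →+* MvPolynomial σ A) J).comap MvPolynomial.C = J := by
  classical
  ext a
  rw [Ideal.mem_comap, MvPolynomial.mem_map_C_iff]
  constructor
  · intro h
    simpa using h 0
  · intro ha m
    rw [MvPolynomial.coeff_C]
    split_ifs
    · exact ha
    · exact J.zero_mem

/-- **`(t, ϖ)` lies over `I + (ϖ)`**: `A ∩ (t, ϖ) = I + (ϖ)` (`x` quasi-regular). [cite: StacksProject, Tag 0BIQ] -/
theorem comap_algebraMap_span_sup_span (hx : IsQuasiRegular x) (ϖ : A) :
    (Ideal.span {algebraMap A (blowupAlgebra (Ideal.span (Set.range x)) (x i)) (x i)} ⊔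
      Ideal.span {algebraMap A (blowupAlgebra (Ideal.span (Set.range x)) (x i)) ϖ}).comap
        (algebraMap A (blowupAlgebra (Ideal.span (Set.range x)) (x i))) =
      Ideal.span (Set.range x) ⊔ Ideal.span {ϖ} := by
  rw [← map_eval_map_C_eq x i ϖ, ← eval_comp_C x i, ← Ideal.comap_comap,
    blowupAlgebra.comap_map_eval x i (ker_eval_le_map_C x i hx ϖ), comap_C_map_C]

/-- `Ideal.map C J ≤ J.comap constantCoeff` in `A[T]`. [folklore] -/
theorem map_C_le_comap_constantCoeff {σ : Type*} (J : Ideal A) :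
    Ideal.map (MvPolynomial.C : A →+* MvPolynomial σ A) J ≤ J.comap MvPolynomial.constantCoeff := by
  rw [Ideal.map_le_iff_le_comap]
  intro a ha
  simpa [Ideal.mem_comap] using ha

/-- **The vertex ideal `(t, ϖ, e_j : j ≠ i) = (𝔪.comap constantCoeff)·A[I/xᵢ]` is prime** when `𝔪 = I + (ϖ)` is prime (`x`
quasi-regular): `A[I/xᵢ]` modulo it is `A/𝔪`. [cite: StacksProject, Tag 0BIQ] -/
theorem isPrime_map_eval_comap_constantCoeff (hx : IsQuasiRegular x) (ϖ : A)
    [(Ideal.span (Set.range x) ⊔ Ideal.span {ϖ}).IsPrime] :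
    (((Ideal.span (Set.range x) ⊔ Ideal.span {ϖ}).comap
        (MvPolynomial.constantCoeff : MvPolynomial {j : Fin r // j ≠ i} A →+* A)).map
      (blowupAlgebra.eval x i).toRingHom).IsPrime :=
  blowupAlgebra.isPrime_map_eval x i ((ker_eval_le_map_C x i hx ϖ).trans (map_C_le_comap_constantCoeff _))

/-- `(t, ϖ) ≤` the vertex ideal. [folklore] -/
theorem span_sup_span_le_map_eval_comap_constantCoeff (ϖ : A) :
    Ideal.span {algebraMap A (blowupAlgebra (Ideal.span (Set.range x)) (x i)) (x i)} ⊔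
        Ideal.span {algebraMap A (blowupAlgebra (Ideal.span (Set.range x)) (x i)) ϖ} ≤
      ((Ideal.span (Set.range x) ⊔ Ideal.span {ϖ}).comap
          (MvPolynomial.constantCoeff : MvPolynomial {j : Fin r // j ≠ i} A →+* A)).map
        (blowupAlgebra.eval x i).toRingHom := by
  rw [← map_eval_map_C_eq x i ϖ]
  exact Ideal.map_mono (map_C_le_comap_constantCoeff _)

/-- The fractions `e_j = x_j/xᵢ`, `j ≠ i`, lie in the vertex ideal. [folklore] -/
theorem frac_mem_map_eval_comap_constantCoeff (ϖ : A) (j : {j : Fin r // j ≠ i}) :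
    blowupAlgebra.frac x i j.1 ∈
      ((Ideal.span (Set.range x) ⊔ Ideal.span {ϖ}).comap
          (MvPolynomial.constantCoeff : MvPolynomial {j : Fin r // j ≠ i} A →+* A)).map
        (blowupAlgebra.eval x i).toRingHom := by
  rw [← blowupAlgebra.eval_X x i j]
  exact Ideal.mem_map_of_mem _ (by simp [Ideal.mem_comap])

/-- **The vertex ideal lies over `I + (ϖ)`** (`x` quasi-regular). [folklore] -/
theorem comap_algebraMap_map_eval_comap_constantCoeff (hx : IsQuasiRegular x) (ϖ : A) :
    (((Ideal.span (Set.range x) ⊔ Ideal.span {ϖ}).comap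
          (MvPolynomial.constantCoeff : MvPolynomial {j : Fin r // j ≠ i} A →+* A)).map
        (blowupAlgebra.eval x i).toRingHom).comap
      (algebraMap A (blowupAlgebra (Ideal.span (Set.range x)) (x i))) =
      Ideal.span (Set.range x) ⊔ Ideal.span {ϖ} := by
  rw [← eval_comp_C x i, ← Ideal.comap_comap,
    blowupAlgebra.comap_map_eval x i ((ker_eval_le_map_C x i hx ϖ).trans (map_C_le_comap_constantCoeff _)), Ideal.comap_comap]
  ext a
  simp

/-- **`(t, ϖ) ≠` the vertex ideal as soon as `r ≥ 2`** (some `e_j`, `j ≠ i`, is not in `(t, ϖ)`: its `eval`-preimage `Ideal.map C 𝔪`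
contains no variable when `𝔪 ≠ A`). [folklore] -/
theorem span_sup_span_ne_map_eval_comap_constantCoeff (hx : IsQuasiRegular x) (ϖ : A)
    (h𝔪 : Ideal.span (Set.range x) ⊔ Ideal.span {ϖ} ≠ ⊤) (j : {j : Fin r // j ≠ i}) :
    Ideal.span {algebraMap A (blowupAlgebra (Ideal.span (Set.range x)) (x i)) (x i)} ⊔
        Ideal.span {algebraMap A (blowupAlgebra (Ideal.span (Set.range x)) (x i)) ϖ} ≠
      ((Ideal.span (Set.range x) ⊔ Ideal.span {ϖ}).comap
          (MvPolynomial.constantCoeff : MvPolynomial {j : Fin r // j ≠ i} A →+* A)).map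
        (blowupAlgebra.eval x i).toRingHom := by
  intro h
  have hX : blowupAlgebra.frac x i j.1 ∈ Ideal.span {algebraMap A (blowupAlgebra (Ideal.span (Set.range x)) (x i)) (x i)} ⊔
      Ideal.span {algebraMap A (blowupAlgebra (Ideal.span (Set.range x)) (x i)) ϖ} :=
    h ▸ frac_mem_map_eval_comap_constantCoeff x i ϖ j
  rw [← map_eval_map_C_eq x i ϖ, ← blowupAlgebra.eval_X x i j] at hX
  have hX' : (MvPolynomial.X j : MvPolynomial {j : Fin r // j ≠ i} A) ∈
      (Ideal.map MvPolynomial.C (Ideal.span (Set.range x) ⊔ Ideal.span {ϖ}) : Ideal (MvPolynomial {j : Fin r // j ≠ i} A)) := by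
    have h2 : (MvPolynomial.X j : MvPolynomial {j : Fin r // j ≠ i} A) ∈
        ((Ideal.map MvPolynomial.C (Ideal.span (Set.range x) ⊔ Ideal.span {ϖ}) :
          Ideal (MvPolynomial {j : Fin r // j ≠ i} A)).map (blowupAlgebra.eval x i).toRingHom).comap
          (blowupAlgebra.eval x i).toRingHom := Ideal.mem_comap.mpr hX
    rwa [blowupAlgebra.comap_map_eval x i (ker_eval_le_map_C x i hx ϖ)] at h2
  classical
  rw [MvPolynomial.mem_map_C_iff] at hX'
  have h1 : (1 : A) ∈ Ideal.span (Set.range x) ⊔ Ideal.span {ϖ} := by simpa using hX' (Finsupp.single j 1)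
  exact h𝔪 ((Ideal.eq_top_iff_one _).mpr h1)

end NonEquimultiple

end Summit.ResolutionOfSingularities.ResolutionOfSingularities.Cruxes.EquisingularLiftNat.Sections

end
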